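import Summits.QuantumFields.YangMills.Theses.FradkinShenkerFlow
import Summits.QuantumFields.YangMills.Theorems.SusceptibilityToPoincare.Negative.Bottleneck
import Literature.MathematicalPhysics.QuantumLattice.GaugeGroupsProofs

/-!
# `SusceptibilityToPoincare` — negative side: the twist bottleneck is NOT removed by `SimplyConnectedSpace G`

Negative-side support for crux `stmt-QuantumFields-9441`
(`Summit.QuantumFields.YangMills.Theses.FradkinShenkerFlow.SusceptibilityToPoincare`, FS ⇒ UP) and for the lead's line
`Cruxes/SusceptibilityToPoincare/Lines/orbit-slice-reduction.lean`, whose open core is cut along `π₁(G)`: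
stub (4a) `stub_fsPoincareInv_simplyConnected` (FS ⇒ UP_inv for SIMPLY-CONNECTED compact simple `G`, "plausibly true")
versus the sentinel (4b) (`¬ SimplyConnectedSpace G`, killed modulo 't Hooft twist inputs for `SO(3)` by the standing
disprover). This file records, kernel-checked, that the SAME bottleneck shape kills (4a), the disprover's repaired statement
`C′ = crux + SimplyConnectedSpace G`, and the crux, at the FIXED simply-connected group `G = SU(2)`, modulo twist-sector
inputs for a REDUCIBLE faithful representation — so the fault line of the crux is not `π₁(G)`.

## The witness family (paper; the hypotheses `hW` below)

`G = SU(2)` (compact, simple — tree `isSimpleCompactGroup_specialUnitaryGroup_holds` — and simply connected),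
`r_k = ρ_{1/2} ⊕ ρ₁^{⊕k}` (fundamental plus `k` copies of the adjoint: a faithful continuous unitary `LatticeRep`,
`N = 2 + 3k`), `β > 0` SMALL and `k` LARGE. Wilson's weight is then
`exp(β Σ_p tr_F U_p + kβ Σ_p χ₁(U_p))`, i.e. the Bhanot–Creutz mixed fundamental–adjoint SU(2) action with
`β_F^{BC} = 2β` and `β_A^{BC} = 3kβ` [Bhanot–Creutz, Phys. Rev. D 24 (1981) 3212]. For `3kβ` above the SO(3) bulk
transition (`β_A^{BC} ≈ 2.5` on the `β_F = 0` axis) and `2β` below the ℤ₂ one (`β_F^{BC} ≈ 0.44` at `β_A = ∞`) the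
system is in "phase II": the adjoint term orders the SO(3) part and makes ℤ₂ monopoles (cubes `c` with
`∏_{p ∈ ∂c} sgn tr_F U_p = −1`) dilute large-field defects of adjoint cost `≥ kβ` each, while the fundamental term is a
ℤ₂ gauge field for the centre signs at coupling `≈ 2β ≪ 0.44`, deep in its disordered regime. Consequences:
* the sign cochain `s_p = sgn tr_F U_p` is an honest GAUGE-INVARIANT plaquette function of the SU(2) links (no lift
  ambiguity), its twist class `w ∈ H²(T⁴; ℤ₂)` (with the standard filling correction on the event `Ω_good` of small
  monopole clusters) is measurable, gauge-invariant and EXACTLY CONSERVED by every single-link replacement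
  `U ↦ U[ℓ ↦ g]` inside `Ω_good` (the cube–plaquette incidence graph on `star(ℓ)` is connected, so a monopole-free
  change of `s` on `star(ℓ)` is `0` or the coboundary `d1_ℓ`) — verbatim the disprover's §2 (2)–(3), which never used
  `G = SO(3)`, only the sign cochain;
* the heat-bath boundary flux of `A_S = {w₁₂ = 0} ∩ Ω_good(S)` is `≤ 2·#E·μ(∂Ω_good) → 0` once `kβ ≥ c₀` (chessboard
  / Peierls bound on monopole clusters of diameter `≥ S/4`; landed glue `hbForm_indicator_le_of_conserved` in the
  disprover's file);
* the sectors are LIGHT: writing `U = σ·Ũ` (`σ ∈ ℤ₂^E`), `s = dσ · s̃(Ũ)` and `[dσ] = 0`, so `w` depends on the SO(3)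
  projection only, and the `σ`-sum at fixed SO(3) data is a ℤ₂ gauge theory at coupling `≈ 2β` whose dependence on the
  class enters only through closed plaquette surfaces wrapping a 2-torus, of relative weight `≤ S²(C tanh 2β)^{S²}`
  (strong-coupling expansion): twisted and untwisted sectors have equal mass up to `e^{−cS²}` given the SO(3) marginal,
  and for the latter 't Hooft's flux duality / confinement give `μ_S(w = τ) → 1/64` ("light magnetic flux";
  de Forcrand–Jahn, Nucl. Phys. B 651 (2003) 125, hep-lat/0211004) — at weak coupling and fixed `S` the ratio is the
  O(1) toron ratio, never `e^{−cβS²}`: the fundamental coupling `2β` is too weak to price the vortex sheet.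
So `δ ≤ μ_S(A_S) ≤ 1 − δ` (open exactly as for SO(3): "not magnetically Higgsed"), FS holds iff the massive/confined
picture of phase II holds (open: weak-coupling mass gap; the perturbative regime contributes summable `|x|^{-8}` tails
of the dimension-4 singlets), and the flux vanishes (rigorous on paper). These are the disprover's conjuncts (i)–(iii)
for SO(3) transported to the simply-connected `SU(2)` through the reducible `r_k`: the adjoint summand supplies the
monopole suppression, the weakness of the centre-faithful summand supplies the lightness. The claim in the line file
that "for π₁(G) = 0 no topological sector of the symmetric torus is protected under link updates" and the disprover's
"for a faithful `r` the sign cochain itself is suppressed, mass `≤ e^{−cβS²}`" both tacitly take `r` irreducible /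
the centre-faithful coupling large.

## What is proved here (sorry-free; nothing asserts a Theses statement positively)

* `not_invariantHeatBathPoincare_of_invariantBottleneck` — the bottleneck lemma on the INVARIANT σ-algebra: gauge-invariant
  events of mass in `[δ, 1−δ]` with vanishing heat-bath flux refute UP_inv(r, β) (every compact `G`, every `r`, real `β`).
* `stub_fsPoincareInv_simplyConnected_false_of_twistInputsSU2` — `SimplyConnectedSpace SU(2)` and the SU(2) twist inputs
  `hW` (FS at some `(r, β ≥ 0)` + gauge-invariant measurable events of non-degenerate mass and vanishing flux) imply
  `¬ stub (4a)` (statement verbatim from the skeleton, sha ca92cafe…/521baf1b…).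
* `susceptibilityToPoincareSC_false_of_twistInputsSU2` — the same inputs refute the disprover's repaired statement
  `C′ = crux + SimplyConnectedSpace G`.
* `susceptibilityToPoincare_false_of_twistInputsSU2` — and (without any `π₁` input) the crux BY NAME.
* `exists_latticeRep_blockSum`, `wilsonAction_blockSum` (§ BlockSum) — ADMISSIBILITY of the witness family: a
  `LatticeRep` stays one after bolting on any continuous unitary block (faithful or not), and Wilson's action of the
  block sum is the sum of the two actions, so `β(S_{1/2} + k S_1)` is `wilsonAction r_k.ρ` of an admissible `r_k`.
Minimal repair suggested to the planner (misses this witness): keep `SimplyConnectedSpace G` AND weaken `∀ β ≥ 0` to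
`∃ β₁(G, r), ∀ β ≥ β₁` (for `β ≥ β₁` every summand of `r`, in particular the centre-faithful one, is strongly coupled and
prices vortex sheets at `e^{−cβS²}`); the route's `closes` only consumes `β ≥ max(β₀(G,r), 0)` and absorbs `β₁` by `max`.
-/

noncomputable section

namespace Summit.QuantumFields.YangMills.Theorems.SusceptibilityToPoincare.Negative

open MeasureTheory ProbabilityTheory Filter Topology
open Literature.MathematicalPhysics.QuantumFieldTheory

variable {G : Type} [Group G] [TopologicalSpace G] [IsTopologicalGroup G] [CompactSpace G]
  [MeasurableSpace G] [BorelSpace G]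

/-- **Bottleneck on the invariant σ-algebra.** Gauge-INVARIANT measurable events `A S` of Wilson mass in `[δ, 1 − δ]`
whose single-link heat-bath flux tends to `0` refute the invariant-sector Poincaré inequality UP_inv(r, β) (the
conclusion of stubs 4a/4b of line orbit-slice-reduction). Every compact `G`, lattice representation `r`, real `β`. [folklore] -/
theorem not_invariantHeatBathPoincare_of_invariantBottleneck (r : LatticeRep G) (β : ℝ) {δ : ℝ} (hδ : 0 < δ)
    (A : ∀ S : ℕ, Set (GaugeConfig 4 (2 * S + 1) G)) (hmeas : ∀ S, MeasurableSet (A S))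
    (hinv : ∀ S, IsGaugeInvariant ((A S).indicator (1 : GaugeConfig 4 (2 * S + 1) G → ℝ)))
    (hmass : ∀ S, δ ≤ (wilsonMeasure (d := 4) (L := 2 * S + 1) r.ρ β).real (A S) ∧
      (wilsonMeasure (d := 4) (L := 2 * S + 1) r.ρ β).real (A S) ≤ 1 - δ)
    (hflux : Tendsto (fun S : ℕ => ∑ ℓ : Edge 4 (2 * S + 1), ∫ U, ∫ g,
        ((A S).indicator (1 : GaugeConfig 4 (2 * S + 1) G → ℝ) U - (A S).indicator 1 (Function.update U ℓ g)) ^ 2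
      ∂((haarProbability G).tilted (fun g' => -β * wilsonAction r.ρ (Function.update U ℓ g')))
      ∂(wilsonMeasure (d := 4) (L := 2 * S + 1) r.ρ β)) atTop (𝓝 0)) :
    ¬ ∃ C : ℝ, ∀ S : ℕ, ∀ F : GaugeConfig 4 (2 * S + 1) G → ℝ, Measurable F → (∃ M : ℝ, ∀ U, |F U| ≤ M) →
      IsGaugeInvariant F →
      variance F (wilsonMeasure (d := 4) (L := 2 * S + 1) r.ρ β) ≤
        C * ∑ ℓ : Edge 4 (2 * S + 1), ∫ U, ∫ g, (F U - F (Function.update U ℓ g)) ^ 2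
          ∂((haarProbability G).tilted (fun g' => -β * wilsonAction r.ρ (Function.update U ℓ g')))
          ∂(wilsonMeasure (d := 4) (L := 2 * S + 1) r.ρ β) := by
  rintro ⟨C, hC⟩
  have hδ1 : δ ≤ 1 - δ := (hmass 0).1.trans (hmass 0).2
  have hpos : 0 < δ * (1 - δ) := mul_pos hδ (by linarith)
  have hle : ∀ S, δ * (1 - δ) ≤ C * ∑ ℓ : Edge 4 (2 * S + 1), ∫ U, ∫ g,
        ((A S).indicator (1 : GaugeConfig 4 (2 * S + 1) G → ℝ) U - (A S).indicator 1 (Function.update U ℓ g)) ^ 2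
      ∂((haarProbability G).tilted (fun g' => -β * wilsonAction r.ρ (Function.update U ℓ g')))
      ∂(wilsonMeasure (d := 4) (L := 2 * S + 1) r.ρ β) := fun S => by
    refine (mul_one_sub_le_mul_one_sub (hmass S).1 (hmass S).2).trans ?_
    rw [← variance_indicator_wilsonMeasure r β S (hmeas S)]
    exact hC S _ (measurable_one.indicator (hmeas S)) ⟨1, fun U => by
      by_cases hU : U ∈ A S <;> simp [Set.indicator, hU]⟩ (hinv S)
  have hlim := hflux.const_mul C
  rw [mul_zero] at hlim
  have : δ * (1 - δ) ≤ 0 := ge_of_tendsto hlim (Eventually.of_forall hle)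
  linarith

/-- `SU(2)` is a compact simple Lie group in the sense of the summit statement (tree: simplicity
`isSimpleCompactGroup_specialUnitaryGroup_holds`, faithful fundamental representation). [folklore] -/
theorem isCompactSimpleLieGroup_su2 : IsCompactSimpleLieGroup (Matrix.specialUnitaryGroup (Fin 2) ℂ) :=
  isCompactSimpleLieGroup_specialUnitaryGroup
    Literature.MathematicalPhysics.QuantumLattice.isSimpleCompactGroup_specialUnitaryGroup_holds le_rfl

/-- **Stub (4a) of line orbit-slice-reduction is false modulo the SU(2) twist inputs.** If `SU(2)` is simply connected
(true; not yet in the tree) and for some faithful unitary lattice representation `r` of `SU(2)` and some `β ≥ 0` —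
intended: `r = ρ_{1/2} ⊕ ρ₁^{⊕k}`, `2β ≲ 0.44 ≪ 3kβ` (phase II of the Bhanot–Creutz plane) — FS holds while
gauge-invariant measurable events (the twist sectors `{w₁₂ = 0} ∩ Ω_good`) keep Wilson mass in `[δ, 1 − δ]` with
vanishing single-link heat-bath flux, then `stub_fsPoincareInv_simplyConnected` (FS ⇒ UP_inv for simply-connected
compact simple `G`, verbatim) is false. [folklore] -/
theorem stub_fsPoincareInv_simplyConnected_false_of_twistInputsSU2
    (hSC : SimplyConnectedSpace (Matrix.specialUnitaryGroup (Fin 2) ℂ))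
    (hW : ∃ (r : LatticeRep (Matrix.specialUnitaryGroup (Fin 2) ℂ)) (β : ℝ), 0 ≤ β ∧
      (∀ A B : YMSpecies (Matrix.specialUnitaryGroup (Fin 2) ℂ), ∃ χ : ℝ, ∀ S : ℕ,
        ∑ x ∈ Literature.Probability.LatticeModels.box 4 S,
        |covariance (fun U => A.F (Literature.MathematicalPhysics.QuantumLattice.torusLift (2 * S + 1) U))
          (fun U => B.F (Literature.MathematicalPhysics.QuantumLattice.configShift (-x)
          (Literature.MathematicalPhysics.QuantumLattice.torusLift (2 * S + 1) U)))
          (wilsonMeasure (d := 4) (L := 2 * S + 1) r.ρ β)| ≤ χ) ∧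
      ∃ δ : ℝ, 0 < δ ∧ ∃ A : (∀ S : ℕ, Set (GaugeConfig 4 (2 * S + 1) (Matrix.specialUnitaryGroup (Fin 2) ℂ))),
        (∀ S, MeasurableSet (A S)) ∧
        (∀ S, IsGaugeInvariant ((A S).indicator
          (1 : GaugeConfig 4 (2 * S + 1) (Matrix.specialUnitaryGroup (Fin 2) ℂ) → ℝ))) ∧
        (∀ S, δ ≤ (wilsonMeasure (d := 4) (L := 2 * S + 1) r.ρ β).real (A S) ∧
          (wilsonMeasure (d := 4) (L := 2 * S + 1) r.ρ β).real (A S) ≤ 1 - δ) ∧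
        Tendsto (fun S : ℕ => ∑ ℓ : Edge 4 (2 * S + 1), ∫ U, ∫ g,
            ((A S).indicator (1 : GaugeConfig 4 (2 * S + 1) (Matrix.specialUnitaryGroup (Fin 2) ℂ) → ℝ) U -
              (A S).indicator 1 (Function.update U ℓ g)) ^ 2
          ∂((haarProbability (Matrix.specialUnitaryGroup (Fin 2) ℂ)).tilted
              (fun g' => -β * wilsonAction r.ρ (Function.update U ℓ g')))
          ∂(wilsonMeasure (d := 4) (L := 2 * S + 1) r.ρ β)) atTop (𝓝 0)) :
    ¬ (∀ (G : Type) [Group G] [TopologicalSpace G] [IsTopologicalGroup G] [CompactSpace G]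
        [MeasurableSpace G] [BorelSpace G], IsCompactSimpleLieGroup G → SimplyConnectedSpace G →
        ∀ (r : LatticeRep G) (β : ℝ), 0 ≤ β →
        (∀ A B : YMSpecies G, ∃ χ : ℝ, ∀ S : ℕ, ∑ x ∈ Literature.Probability.LatticeModels.box 4 S,
          |covariance (fun U => A.F (Literature.MathematicalPhysics.QuantumLattice.torusLift (2 * S + 1) U))
            (fun U => B.F (Literature.MathematicalPhysics.QuantumLattice.configShift (-x)
            (Literature.MathematicalPhysics.QuantumLattice.torusLift (2 * S + 1) U)))
            (wilsonMeasure r.ρ β : Measure (GaugeConfig 4 (2 * S + 1) G))| ≤ χ) →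
        ∃ C : ℝ, ∀ S : ℕ, ∀ F : GaugeConfig 4 (2 * S + 1) G → ℝ, Measurable F → (∃ M : ℝ, ∀ U, |F U| ≤ M) →
          IsGaugeInvariant F →
          variance F (wilsonMeasure r.ρ β : Measure (GaugeConfig 4 (2 * S + 1) G)) ≤
            C * ∑ ℓ : Edge 4 (2 * S + 1), ∫ U, ∫ g, (F U - F (Function.update U ℓ g)) ^ 2
              ∂((haarProbability G).tilted (fun g' => -β * wilsonAction r.ρ (Function.update U ℓ g')))
              ∂(wilsonMeasure r.ρ β : Measure (GaugeConfig 4 (2 * S + 1) G))) := by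
  intro hstub
  obtain ⟨r, β, hβ, hFS, δ, hδ, A, hmeas, hinv, hmass, hflux⟩ := hW
  exact not_invariantHeatBathPoincare_of_invariantBottleneck r β hδ A hmeas hinv hmass hflux
    (hstub (Matrix.specialUnitaryGroup (Fin 2) ℂ) isCompactSimpleLieGroup_su2 hSC r β hβ hFS)

/-- **The disprover's repaired statement `C′ = crux + SimplyConnectedSpace G` is bitten by the same witness**
(`Cruxes/SusceptibilityToPoincare/Disproof.lean`, `SusceptibilityToPoincareSC`, restated verbatim): the SU(2)
twist inputs refute it. Minimal repair that misses the witness: additionally weaken `∀ β ≥ 0` to `∃ β₁ ∀ β ≥ β₁`. [folklore] -/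
theorem susceptibilityToPoincareSC_false_of_twistInputsSU2
    (hSC : SimplyConnectedSpace (Matrix.specialUnitaryGroup (Fin 2) ℂ))
    (hW : ∃ (r : LatticeRep (Matrix.specialUnitaryGroup (Fin 2) ℂ)) (β : ℝ), 0 ≤ β ∧
      (∀ A B : YMSpecies (Matrix.specialUnitaryGroup (Fin 2) ℂ), ∃ χ : ℝ, ∀ S : ℕ,
        ∑ x ∈ Literature.Probability.LatticeModels.box 4 S,
        |covariance (fun U => A.F (Literature.MathematicalPhysics.QuantumLattice.torusLift (2 * S + 1) U))
          (fun U => B.F (Literature.MathematicalPhysics.QuantumLattice.configShift (-x)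
          (Literature.MathematicalPhysics.QuantumLattice.torusLift (2 * S + 1) U)))
          (wilsonMeasure (d := 4) (L := 2 * S + 1) r.ρ β)| ≤ χ) ∧
      ∃ δ : ℝ, 0 < δ ∧ ∃ A : (∀ S : ℕ, Set (GaugeConfig 4 (2 * S + 1) (Matrix.specialUnitaryGroup (Fin 2) ℂ))),
        (∀ S, MeasurableSet (A S)) ∧
        (∀ S, IsGaugeInvariant ((A S).indicator
          (1 : GaugeConfig 4 (2 * S + 1) (Matrix.specialUnitaryGroup (Fin 2) ℂ) → ℝ))) ∧
        (∀ S, δ ≤ (wilsonMeasure (d := 4) (L := 2 * S + 1) r.ρ β).real (A S) ∧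
          (wilsonMeasure (d := 4) (L := 2 * S + 1) r.ρ β).real (A S) ≤ 1 - δ) ∧
        Tendsto (fun S : ℕ => ∑ ℓ : Edge 4 (2 * S + 1), ∫ U, ∫ g,
            ((A S).indicator (1 : GaugeConfig 4 (2 * S + 1) (Matrix.specialUnitaryGroup (Fin 2) ℂ) → ℝ) U -
              (A S).indicator 1 (Function.update U ℓ g)) ^ 2
          ∂((haarProbability (Matrix.specialUnitaryGroup (Fin 2) ℂ)).tilted
              (fun g' => -β * wilsonAction r.ρ (Function.update U ℓ g')))
          ∂(wilsonMeasure (d := 4) (L := 2 * S + 1) r.ρ β)) atTop (𝓝 0)) :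
    ¬ (∀ (G : Type) [Group G] [TopologicalSpace G] [IsTopologicalGroup G] [CompactSpace G]
        [MeasurableSpace G] [BorelSpace G], IsCompactSimpleLieGroup G → SimplyConnectedSpace G →
        ∀ (r : LatticeRep G) (β : ℝ), 0 ≤ β →
        (∀ A B : YMSpecies G, ∃ χ : ℝ, ∀ S : ℕ, ∑ x ∈ Literature.Probability.LatticeModels.box 4 S,
          |covariance (fun U => A.F (Literature.MathematicalPhysics.QuantumLattice.torusLift (2 * S + 1) U))
            (fun U => B.F (Literature.MathematicalPhysics.QuantumLattice.configShift (-x)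
            (Literature.MathematicalPhysics.QuantumLattice.torusLift (2 * S + 1) U)))
            (wilsonMeasure (d := 4) (L := 2 * S + 1) r.ρ β)| ≤ χ) →
        ∃ C : ℝ, ∀ S : ℕ, ∀ F : GaugeConfig 4 (2 * S + 1) G → ℝ, Measurable F → (∃ M : ℝ, ∀ U, |F U| ≤ M) →
          variance F (wilsonMeasure (d := 4) (L := 2 * S + 1) r.ρ β) ≤
            C * ∑ ℓ : Edge 4 (2 * S + 1), ∫ U, ∫ g, (F U - F (Function.update U ℓ g)) ^ 2
              ∂((haarProbability G).tilted (fun g' => -β * wilsonAction r.ρ (Function.update U ℓ g')))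
              ∂(wilsonMeasure (d := 4) (L := 2 * S + 1) r.ρ β)) := by
  intro hSCcrux
  obtain ⟨r, β, hβ, hFS, δ, hδ, A, hmeas, hinv, hmass, hflux⟩ := hW
  obtain ⟨C, hC⟩ := hSCcrux (Matrix.specialUnitaryGroup (Fin 2) ℂ) isCompactSimpleLieGroup_su2 hSC r β hβ hFS
  exact not_invariantHeatBathPoincare_of_invariantBottleneck r β hδ A hmeas hinv hmass hflux
    ⟨C, fun S F hF hM _ => hC S F hF hM⟩

/-- **The crux by name, modulo the SU(2) twist inputs** (no `π₁` hypothesis enters): finite susceptibility at a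
phase-II point of the mixed fundamental–adjoint SU(2) action together with light, conserved twist sectors refutes
`SusceptibilityToPoincare` as typed. Conjuncts of `hW`: FS there and non-degenerate sector mass are OPEN
(weak-coupling mass gap / "not magnetically Higgsed"); the flux bound is rigorous on paper; none is constructible in
the tree today. [folklore] -/
theorem susceptibilityToPoincare_false_of_twistInputsSU2
    (hW : ∃ (r : LatticeRep (Matrix.specialUnitaryGroup (Fin 2) ℂ)) (β : ℝ), 0 ≤ β ∧
      (∀ A B : YMSpecies (Matrix.specialUnitaryGroup (Fin 2) ℂ), ∃ χ : ℝ, ∀ S : ℕ,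
        ∑ x ∈ Literature.Probability.LatticeModels.box 4 S,
        |covariance (fun U => A.F (Literature.MathematicalPhysics.QuantumLattice.torusLift (2 * S + 1) U))
          (fun U => B.F (Literature.MathematicalPhysics.QuantumLattice.configShift (-x)
          (Literature.MathematicalPhysics.QuantumLattice.torusLift (2 * S + 1) U)))
          (wilsonMeasure (d := 4) (L := 2 * S + 1) r.ρ β)| ≤ χ) ∧
      ∃ δ : ℝ, 0 < δ ∧ ∃ A : (∀ S : ℕ, Set (GaugeConfig 4 (2 * S + 1) (Matrix.specialUnitaryGroup (Fin 2) ℂ))),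
        (∀ S, MeasurableSet (A S)) ∧
        (∀ S, IsGaugeInvariant ((A S).indicator
          (1 : GaugeConfig 4 (2 * S + 1) (Matrix.specialUnitaryGroup (Fin 2) ℂ) → ℝ))) ∧
        (∀ S, δ ≤ (wilsonMeasure (d := 4) (L := 2 * S + 1) r.ρ β).real (A S) ∧
          (wilsonMeasure (d := 4) (L := 2 * S + 1) r.ρ β).real (A S) ≤ 1 - δ) ∧
        Tendsto (fun S : ℕ => ∑ ℓ : Edge 4 (2 * S + 1), ∫ U, ∫ g,
            ((A S).indicator (1 : GaugeConfig 4 (2 * S + 1) (Matrix.specialUnitaryGroup (Fin 2) ℂ) → ℝ) U -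
              (A S).indicator 1 (Function.update U ℓ g)) ^ 2
          ∂((haarProbability (Matrix.specialUnitaryGroup (Fin 2) ℂ)).tilted
              (fun g' => -β * wilsonAction r.ρ (Function.update U ℓ g')))
          ∂(wilsonMeasure (d := 4) (L := 2 * S + 1) r.ρ β)) atTop (𝓝 0)) :
    ¬ Summit.QuantumFields.YangMills.Theses.FradkinShenkerFlow.SusceptibilityToPoincare := by
  intro hcrux
  obtain ⟨r, β, hβ, hFS, δ, hδ, A, hmeas, hinv, hmass, hflux⟩ := hW
  obtain ⟨C, hC⟩ := hcrux (Matrix.specialUnitaryGroup (Fin 2) ℂ) isCompactSimpleLieGroup_su2 r β hβ hFS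
  exact not_invariantHeatBathPoincare_of_invariantBottleneck r β hδ A hmeas hinv hmass hflux
    ⟨C, fun S F hF hM _ => hC S F hF hM⟩


/-! ### Admissibility of the witness family: `LatticeRep` is closed under bolting on ANY continuous unitary summand

The crux quantifies `∀ r : LatticeRep G`. A `LatticeRep` stays a `LatticeRep` after adding an arbitrary continuous
unitary block `ρ'` — faithful or not, e.g. `k` copies of the centre-blind adjoint representation — and Wilson's action of
the block sum is the SUM of the two Wilson actions, so the mixed fundamental–adjoint actions `β(S_{1/2} + k S_1)` of the
witness family are Wilson actions of admissible `(G, r, β)` in the sense of the crux. -/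

section BlockSum

variable {G : Type} [Group G] [TopologicalSpace G]

omit [TopologicalSpace G] in
/-- Trace of a reindexed block sum: `tr (A ⊕ D) = tr A + tr D`. [folklore] -/
theorem trace_reindex_fromBlocks {n m : ℕ} (A : Matrix (Fin n) (Fin n) ℂ) (D : Matrix (Fin m) (Fin m) ℂ) :
    (Matrix.reindex finSumFinEquiv finSumFinEquiv (Matrix.fromBlocks A 0 0 D)).trace = A.trace + D.trace := by
  simp only [Matrix.trace, Matrix.reindex_apply, Matrix.diag, Matrix.submatrix_apply]
  rw [← Equiv.sum_comp finSumFinEquiv]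
  simp [Fintype.sum_sum_type, Matrix.fromBlocks]

/-- **Block sums are lattice representations.** For every lattice representation `r` of `G` and every continuous
unitary matrix representation `ρ'` of `G` (no faithfulness asked of `ρ'`), the block sum `r.ρ ⊕ ρ'`, reindexed to
`Fin (r.N + m)`, is again a `LatticeRep` (faithful through the first block); recorded through its dimension and its
character `tr (r.ρ ⊕ ρ') = tr r.ρ + tr ρ'`, which is all Wilson's action sees (`wilsonAction_blockSum`). [folklore] -/
theorem exists_latticeRep_blockSum (r : LatticeRep G) {m : ℕ} (ρ' : G →* Matrix (Fin m) (Fin m) ℂ)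
    (hc : Continuous ρ') (hu : ∀ g, ρ' g ∈ Matrix.unitaryGroup (Fin m) ℂ) :
    ∃ r₂ : LatticeRep G, r₂.N = r.N + m ∧ ∀ g, (r₂.ρ g).trace = (r.ρ g).trace + (ρ' g).trace := by
  classical
  -- the block-sum homomorphism
  let φ : G →* Matrix (Fin (r.N + m)) (Fin (r.N + m)) ℂ :=
    { toFun := fun g => Matrix.reindex finSumFinEquiv finSumFinEquiv (Matrix.fromBlocks (r.ρ g) 0 0 (ρ' g))
      map_one' := by
        simp only [map_one, Matrix.fromBlocks_one, Matrix.reindex_apply, Matrix.submatrix_one_equiv]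
      map_mul' := fun g h => by
        simp only [map_mul, Matrix.reindex_apply, Matrix.submatrix_mul_equiv, Matrix.fromBlocks_multiply,
          Matrix.mul_zero, Matrix.zero_mul, add_zero, zero_add] }
  have hφ : ∀ g, φ g = Matrix.reindex finSumFinEquiv finSumFinEquiv (Matrix.fromBlocks (r.ρ g) 0 0 (ρ' g)) :=
    fun g => rfl
  refine ⟨⟨r.N + m, φ, ?_, ?_, ?_⟩, rfl, fun g => by rw [hφ, trace_reindex_fromBlocks]⟩
  · -- continuity: entrywise
    show Continuous fun g => Matrix.reindex finSumFinEquiv finSumFinEquiv (Matrix.fromBlocks (r.ρ g) 0 0 (ρ' g))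
    exact (Continuous.matrix_fromBlocks r.continuous continuous_const continuous_const hc).matrix_reindex _ _
  · -- injectivity through the first block
    intro g h hgh
    have h1 : Matrix.fromBlocks (r.ρ g) 0 0 (ρ' g) = Matrix.fromBlocks (r.ρ h) 0 0 (ρ' h) :=
      (Matrix.reindex finSumFinEquiv finSumFinEquiv).injective (by simpa only [hφ] using hgh)
    exact r.injective (Matrix.fromBlocks_inj.1 h1).1
  · -- unitarity: (A ⊕ D)(A ⊕ D)ᴴ = AAᴴ ⊕ DDᴴ = 1
    intro g
    have hA : r.ρ g * star (r.ρ g) = 1 := Matrix.mem_unitaryGroup_iff.1 (r.mem_unitary g)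
    have hD : ρ' g * star (ρ' g) = 1 := Matrix.mem_unitaryGroup_iff.1 (hu g)
    rw [hφ, Matrix.mem_unitaryGroup_iff, Matrix.star_eq_conjTranspose, Matrix.conjTranspose_reindex,
      Matrix.reindex_apply, Matrix.reindex_apply, Matrix.submatrix_mul_equiv, Matrix.fromBlocks_conjTranspose,
      Matrix.fromBlocks_multiply]
    rw [Matrix.star_eq_conjTranspose] at hA hD
    simp only [Matrix.conjTranspose_zero, Matrix.mul_zero, Matrix.zero_mul, add_zero, zero_add, hA, hD,
      Matrix.fromBlocks_one, Matrix.submatrix_one_equiv]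

/-- **Wilson's action of a block sum is the sum of the Wilson actions** (`S_{r ⊕ ρ'} = S_r + S_{ρ'}`): with
`ρ' = ρ₁^{⊕k}` this is the mixed action `S_{1/2} + k S_1` of the witness family, at ONE coupling `β`. [folklore] -/
theorem wilsonAction_blockSum {d L : ℕ} [NeZero L] (r : LatticeRep G) {m : ℕ} (ρ' : G →* Matrix (Fin m) (Fin m) ℂ)
    (r₂ : LatticeRep G) (hN : r₂.N = r.N + m)
    (hρ : ∀ g, (r₂.ρ g).trace = (r.ρ g).trace + (ρ' g).trace) (U : GaugeConfig d L G) :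
    wilsonAction r₂.ρ U = wilsonAction r.ρ U + wilsonAction ρ' U := by
  simp only [wilsonAction, hρ, hN, Nat.cast_add, Complex.add_re, ← Finset.sum_add_distrib]
  exact Finset.sum_congr rfl fun p _ => by ring

end BlockSum

end Summit.QuantumFields.YangMills.Theorems.SusceptibilityToPoincare.Negative

end
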